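import Summits.CriticalPhenomena.PercolationContinuityZ3.Theorems.PercNearOneGluingNoHeavyLowerTailSahiCoordinateQuarticRung
import Summits.CriticalPhenomena.PercolationContinuityZ3.Theorems.PercNearOneGluingNoHeavyLowerTailSahiSunflowerFourPointAllOrders
import Summits.CriticalPhenomena.PercolationContinuityZ3.Theorems.PercNearOneGluingNoHeavyLowerTailSahiE4HittingPercolation
import Summits.CriticalPhenomena.PercolationContinuityZ3.Theorems.PercNearOneGluingNoHeavyLowerTailSahiCombDisjunctThreeIdentities
import Summits.CriticalPhenomena.PercolationContinuityZ3.Theorems.PercNearOneGluingNoHeavyQuantLevelTrials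
import Literature.Combinatorics.Sahi2008.Percolation
import Mathlib.Tactic.Linarith
import HarnessLib

/-!
# `NoHeavyLowerTail` (crux stmt-CriticalPhenomena-4575), master-family line P1 (abstract tower): the order-4 rung law on the 4-CO-SUNFLOWER class
# `U_i = ⋃_{j ≠ i} G_j` — typed, with its reduction to Sahi's `C_4` on that class, i.e. to AT_4 = Kahn–Sahi `C_4` on the complements of a
# four-petal sunflower of increasing events, and hence to **4PT-LB** (`SahiDeltaSystem.FourPointLBRow`)

Support file (seat `prim-masterthm-p1`, gen 7; `--supports stmt-CriticalPhenomena-4575`); ONE `@[conjecture]` definition (`CoSunflowerFourRung`, an obligation of THIS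
programme — census-backed, NOT a published fact), no sorry.  Memo `run/shared/lean/prim/prim-masterthm/FROM-prim-masterthm-p1-g7-CLASS-TANGENT.md` §6.
The order-3 twin is `…SahiCoSunflowerTwoLevel` (p317756); the general order-4 rung law and its local step are `…SahiCoordinateQuarticRung`.

* `coSun4 G` — the 4-co-sunflower `![G₁∪G₂∪G₃, G₀∪G₂∪G₃, G₀∪G₁∪G₃, G₀∪G₁∪G₂]` of four increasing events (⟺ an increasing quadruple all of whose pairwise
  unions coincide, `eq_union_inter₃`).  Its sections along a coordinate are the 4-co-sunflowers of the sections (`secAt_coSun4`), so the class is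
  closed under the induction.
* `CoSunflowerFourRung` — **CONJECTURE (RUNG-4 on the class)**: the three one-coordinate rung pieces of `E_4(coSun4 G)` (`4B₁ ≥ B₀`, `B₂ ≥ 0`, `4B₃ ≥ B₄`) are `≥ 0`
  at every coordinate.  CENSUS (this seat, exact, engine code-g7/census5/quart.c): ALL 4-co-sunflowers on `≤ 4` coordinates (24 133 200 tuples `G`, kit j150453), every axis and
  fibre, and 1.8·10⁶ structured-random ones on 5 coordinates (kit j150455): 0 violations; on the class even the λ = 1 top law `4B₃ ≥ 3B₄` (false for general quadruples
  on 5 coordinates) has 0 violations in both.  (It is the `k = 4` analogue of the tangent law of the order-3 class; the general-quadruple version is `SahiCoordinateQuarticRung.FourRung`.)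
* `sahiE_four_coSun4_nonneg_of_rung` — **REDUCTION**: `CoSunflowerFourRung → E_4(μ_p; coSun4 G) ≥ 0`; `sahiE_four_nonneg_of_pairwise_union_eq`; the sunflower-complement
  forms `sahiE4_compl_lowerSunflower_nonneg_of_rung` (decreasing four-petal sunflower) and `sahiE4_compl_sunflower_nonneg_of_rung` (increasing one, by the reflection
  `ω ↦ ωᶜ`, `p ↦ 1 − p` — this is AT_4, the `m = 4` row of the abstract tower), which is exactly the shape of
* **`fourPointLBRow_of_coSunflowerFourRung : CoSunflowerFourRung → SahiDeltaSystem.FourPointLBRow`** — 4PT-LB (`0 ≤ E₄(D_a,D_b,D_c,D_d)`, `D_x` = "the three terminals other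
  than `x` are not all joined", every finite weighted graph): the four events `triConn` are increasing with all pairwise intersections = "all four joined"
  (`triConn_inter₀₁ … ₂₃`).
HONEST FRAMING: typed conjecture + reductions; `CoSunflowerFourRung`, AT_4 and 4PT-LB remain OPEN.  Axioms standard. [this work]
-/

noncomputable section

open scoped Classical

namespace Summit.CriticalPhenomena.PercolationContinuityZ3.Theorems

namespace SahiCoSunflowerFourRung

open Finset Function
open Literature.Combinatorics.Sahi2008
open Literature.Probability.LatticeModels (sahiE4 prodBernoulli)
open Literature.Probability.Percolation (DeterminedBy determinedBy_iff openConn BondConfig isUpperSet_openConn)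
open Literature.Probability.Percolation.DecisionTree (ind ind_of_mem ind_of_not_mem ind_nonneg)
open SahiCoordinateQuarticRung (rungPiece₁ rungPiece₂ rungPiece₃ sahiE_four_nonneg_of_rungAt)

variable {ι : Type} [Fintype ι]

/-! ### 1. The class and its sections -/

/-- The 4-co-sunflower of four events: member `i` is the union of the other three. [this work] -/
def coSun4 (G : Fin 4 → Set (Set ι)) : Fin 4 → Set (Set ι) :=
  ![G 1 ∪ G 2 ∪ G 3, G 0 ∪ G 2 ∪ G 3, G 0 ∪ G 1 ∪ G 3, G 0 ∪ G 1 ∪ G 2]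

omit [Fintype ι] in
/-- Members of a 4-co-sunflower of increasing events are increasing. [folklore] -/
theorem isUpperSet_coSun4 {G : Fin 4 → Set (Set ι)} (hG : ∀ j, IsUpperSet (G j)) (i : Fin 4) : IsUpperSet (coSun4 G i) := by
  fin_cases i
  · exact ((hG 1).union (hG 2)).union (hG 3)
  · exact ((hG 0).union (hG 2)).union (hG 3)
  · exact ((hG 0).union (hG 1)).union (hG 3)
  · exact ((hG 0).union (hG 1)).union (hG 2)

omit [Fintype ι] in
/-- Members of a 4-co-sunflower of events determined by `S` are determined by `S`. [folklore] -/
theorem determinedBy_coSun4 {G : Fin 4 → Set (Set ι)} {S : Set ι} (hG : ∀ j, DeterminedBy (G j) S) (i : Fin 4) :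
    DeterminedBy (coSun4 G i) S := by
  fin_cases i
  · exact Quant.determinedBy_union_of (Quant.determinedBy_union_of (hG 1) (hG 2)) (hG 3)
  · exact Quant.determinedBy_union_of (Quant.determinedBy_union_of (hG 0) (hG 2)) (hG 3)
  · exact Quant.determinedBy_union_of (Quant.determinedBy_union_of (hG 0) (hG 1)) (hG 3)
  · exact Quant.determinedBy_union_of (Quant.determinedBy_union_of (hG 0) (hG 1)) (hG 2)

omit [Fintype ι] in
/-- **Sections of a 4-co-sunflower are the 4-co-sunflower of the sections.** [this work] -/
theorem secAt_coSun4 (e : ι) (b : Bool) (G : Fin 4 → Set (Set ι)) :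
    (fun i => secAt e b (coSun4 G i)) = coSun4 (fun j => secAt e b (G j)) := by
  funext i
  fin_cases i <;> simp [coSun4, SahiCombDisjunct.secAt_union]

omit [Fintype ι] in
/-- The indicator family of an explicit 4-co-sunflower, as a vector. [folklore] -/
theorem ind_coSun4_vec (X Y Z T : Set (Set ι)) :
    (fun i => ind (coSun4 ![X, Y, Z, T] i)) = ![ind (Y ∪ Z ∪ T), ind (X ∪ Z ∪ T), ind (X ∪ Y ∪ T), ind (X ∪ Y ∪ Z)] := by
  funext i
  fin_cases i <;> simp [coSun4]

/-! ### 2. The class rung law, typed, and the reduction -/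

/-- **CONJECTURE (RUNG-4 on the 4-co-sunflower class)**, an obligation of this programme (NOT a published fact): for every finite cube, every product weight
`p`, every four increasing events `G_0..G_3` and EVERY coordinate `e`, the three one-coordinate rung pieces of `E_4(μ_p; coSun4 G)` are nonnegative
(`4B₁ ≥ B₀`, `B₂ ≥ 0`, `4B₃ ≥ B₄`).  Census: exhaustive on `≤ 4` coordinates (24 133 200 tuples, kit j150453) and 1.8·10⁶ random tuples on 5 coordinates (kit j150455):
0 violations.  Implies `E_4 ≥ 0` on the class, AT_4, and 4PT-LB (below). [cite: Sahi2008, Conj. 5 (p. 212); LiebSahi2021, Conj. 1.1] [status: open] -/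
@[conjecture] def CoSunflowerFourRung : Prop :=
  ∀ (ι : Type) [Fintype ι] (p : ι → unitInterval) (G : Fin 4 → Set (Set ι)), (∀ j, IsUpperSet (G j)) →
    ∀ e : ι, 0 ≤ rungPiece₁ p e (coSun4 G) ∧ 0 ≤ rungPiece₂ p e (coSun4 G) ∧ 0 ≤ rungPiece₃ p e (coSun4 G)

/-- **`C_4` ON THE 4-CO-SUNFLOWER CLASS from the class rung law** (induction on a determining set; `secAt_coSun4` keeps the induction inside the class). [this work] -/
theorem sahiE_four_coSun4_nonneg_of_rung (h : CoSunflowerFourRung) {κ : Type} [Fintype κ] (p : κ → unitInterval)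
    {G : Fin 4 → Set (Set κ)} (hG : ∀ j, IsUpperSet (G j)) :
    0 ≤ sahiE (bernoulliWeight p) 4 (fun i => ind (coSun4 G i)) := by
  suffices key : ∀ (m : ℕ) (H : Fin 4 → Set (Set κ)) (S : Finset κ), S.card = m → (∀ j, IsUpperSet (H j)) →
      (∀ j, DeterminedBy (H j) (↑S : Set κ)) → 0 ≤ sahiE (bernoulliWeight p) 4 (fun i => ind (coSun4 H i)) from
    key _ G Finset.univ rfl hG fun j => (determinedBy_iff _ _).2 fun ω ω' hω => by
      rw [Finset.coe_univ, Set.inter_univ, Set.inter_univ] at hω; rw [hω]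
  intro m
  induction m using Nat.strong_induction_on with
  | _ m ih =>
  intro H S hS hH hHS
  rcases S.eq_empty_or_nonempty with hSe | hSne
  · subst hSe
    exact (masterFamilyEqIff_mpr 4 κ p (coSun4 H)
      (suppZeroFlag_of_pairwise_disjoint 2 (coSun4 H) (fun _ => ∅) (fun _ _ _ => disjoint_bot_left)
        (determinedBy_coSun4 hHS))).ge
  · obtain ⟨e, heS⟩ := hSne
    have hlt : (S.erase e).card < m := by rw [← hS]; exact Finset.card_erase_lt_of_mem heS
    have E0 := ih _ hlt (fun j => secAt e false (H j)) (S.erase e) rfl (fun j => isUpperSet_secAt e false (hH j))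
      (fun j => determinedBy_secAt e false (hHS j))
    have E1 := ih _ hlt (fun j => secAt e true (H j)) (S.erase e) rfl (fun j => isUpperSet_secAt e true (hH j))
      (fun j => determinedBy_secAt e true (hHS j))
    rw [← secAt_coSun4] at E0 E1
    obtain ⟨h1, h2, h3⟩ := h κ p H hH e
    exact sahiE_four_nonneg_of_rungAt p e (coSun4 H) h1 h2 h3 E0 E1

/-- The same with four explicit events. [this work] -/
theorem sahiE_four_coSun4_nonneg_of_rung' (h : CoSunflowerFourRung) {κ : Type} [Fintype κ] (p : κ → unitInterval)
    {G₀ G₁ G₂ G₃ : Set (Set κ)} (h₀ : IsUpperSet G₀) (h₁ : IsUpperSet G₁) (h₂ : IsUpperSet G₂) (h₃ : IsUpperSet G₃) :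
    0 ≤ sahiE (bernoulliWeight p) 4 ![ind (G₁ ∪ G₂ ∪ G₃), ind (G₀ ∪ G₂ ∪ G₃), ind (G₀ ∪ G₁ ∪ G₃), ind (G₀ ∪ G₁ ∪ G₂)] := by
  have key := sahiE_four_coSun4_nonneg_of_rung h p (G := ![G₀, G₁, G₂, G₃]) (by intro j; fin_cases j <;> assumption)
  rw [ind_coSun4_vec] at key
  exact key

/-! ### 3. Increasing quadruples with equal pairwise unions -/

omit [Fintype ι] in
/-- If all pairwise unions of `U₀..U₃` coincide then `U₀ = (U₀∩U₂∩U₃) ∪ (U₀∩U₁∩U₃) ∪ (U₀∩U₁∩U₂)` (a member that missed two others `U_j, U_k` would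
miss `U_j ∪ U_k = U₀ ∪ U_j`). [this work] -/
theorem eq_union_inter₃ {U₀ U₁ U₂ U₃ W : Set (Set ι)} (h01 : U₀ ∪ U₁ = W) (h12 : U₁ ∪ U₂ = W) (h13 : U₁ ∪ U₃ = W) (h23 : U₂ ∪ U₃ = W) :
    U₀ ∩ U₂ ∩ U₃ ∪ U₀ ∩ U₁ ∩ U₃ ∪ U₀ ∩ U₁ ∩ U₂ = U₀ := by
  ext ω
  constructor
  · rintro ((⟨⟨h, -⟩, -⟩ | ⟨⟨h, -⟩, -⟩) | ⟨⟨h, -⟩, -⟩) <;> exact h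
  · intro h0
    have hW : ω ∈ W := by rw [← h01]; exact Or.inl h0
    have e12 : ω ∈ U₁ ∨ ω ∈ U₂ := by rw [← Set.mem_union, h12]; exact hW
    have e13 : ω ∈ U₁ ∨ ω ∈ U₃ := by rw [← Set.mem_union, h13]; exact hW
    have e23 : ω ∈ U₂ ∨ ω ∈ U₃ := by rw [← Set.mem_union, h23]; exact hW
    rcases e12 with h1 | h2
    · rcases e23 with h2 | h3
      · exact Or.inr ⟨⟨h0, h1⟩, h2⟩
      · exact Or.inl (Or.inr ⟨⟨h0, h1⟩, h3⟩)
    · rcases e13 with h1 | h3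
      · exact Or.inr ⟨⟨h0, h1⟩, h2⟩
      · exact Or.inl (Or.inl ⟨⟨h0, h2⟩, h3⟩)

/-- **`C_4` for increasing quadruples with equal pairwise unions** (they are the 4-co-sunflower of `G_j := ⋂_{i ≠ j} U_i`), conditional on
`CoSunflowerFourRung`. [this work] -/
theorem sahiE_four_nonneg_of_pairwise_union_eq (h : CoSunflowerFourRung) {κ : Type} [Fintype κ] (p : κ → unitInterval)
    {U₀ U₁ U₂ U₃ W : Set (Set κ)} (hU₀ : IsUpperSet U₀) (hU₁ : IsUpperSet U₁) (hU₂ : IsUpperSet U₂) (hU₃ : IsUpperSet U₃)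
    (h01 : U₀ ∪ U₁ = W) (h02 : U₀ ∪ U₂ = W) (h03 : U₀ ∪ U₃ = W) (h12 : U₁ ∪ U₂ = W) (h13 : U₁ ∪ U₃ = W) (h23 : U₂ ∪ U₃ = W) :
    0 ≤ sahiE (bernoulliWeight p) 4 ![ind U₀, ind U₁, ind U₂, ind U₃] := by
  have key := sahiE_four_coSun4_nonneg_of_rung' h p ((hU₁.inter hU₂).inter hU₃) ((hU₀.inter hU₂).inter hU₃)
    ((hU₀.inter hU₁).inter hU₃) ((hU₀.inter hU₁).inter hU₂)
  have c0 := eq_union_inter₃ h01 h12 h13 h23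
  have c1 : U₁ ∩ U₂ ∩ U₃ ∪ U₀ ∩ U₁ ∩ U₃ ∪ U₀ ∩ U₁ ∩ U₂ = U₁ := by
    have := eq_union_inter₃ (U₀ := U₁) (U₁ := U₀) (U₂ := U₂) (U₃ := U₃) (W := W) (by rw [Set.union_comm, h01]) h02 h03 h23
    rw [Set.inter_comm U₁ U₀] at this; exact this
  have c2 : U₁ ∩ U₂ ∩ U₃ ∪ U₀ ∩ U₂ ∩ U₃ ∪ U₀ ∩ U₁ ∩ U₂ = U₂ := by
    have := eq_union_inter₃ (U₀ := U₂) (U₁ := U₁) (U₂ := U₀) (U₃ := U₃) (W := W) (by rw [Set.union_comm, h12])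
      (by rw [Set.union_comm, h01]) h13 h03
    -- this : U₂ ∩ U₀ ∩ U₃ ∪ U₂ ∩ U₁ ∩ U₃ ∪ U₂ ∩ U₁ ∩ U₀ = U₂
    rw [← this]; ext ω; simp only [Set.mem_union, Set.mem_inter_iff]; tauto
  have c3 : U₁ ∩ U₂ ∩ U₃ ∪ U₀ ∩ U₂ ∩ U₃ ∪ U₀ ∩ U₁ ∩ U₃ = U₃ := by
    have := eq_union_inter₃ (U₀ := U₃) (U₁ := U₁) (U₂ := U₂) (U₃ := U₀) (W := W) (by rw [Set.union_comm, h13]) h12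
      (by rw [Set.union_comm, h01]) (by rw [Set.union_comm, h02])
    -- this : U₃ ∩ U₂ ∩ U₀ ∪ U₃ ∩ U₁ ∩ U₀ ∪ U₃ ∩ U₁ ∩ U₂ = U₃
    rw [← this]; ext ω; simp only [Set.mem_union, Set.mem_inter_iff]; tauto
  rw [c0, c1, c2, c3] at key
  exact key

/-! ### 4. Sunflower complements (both monotonicities) and 4PT-LB -/

/-- **Decreasing four-petal sunflower**: for down-sets `D₀..D₃` with all pairwise intersections equal to `K`, the complements are increasing with equal pairwise
unions, so `CoSunflowerFourRung` gives `0 ≤ E_4(μ_p; D₀ᶜ, D₁ᶜ, D₂ᶜ, D₃ᶜ)`. [this work] -/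
theorem sahiE4_compl_lowerSunflower_nonneg_of_rung (h : CoSunflowerFourRung) {κ : Type} [Fintype κ] (p : κ → unitInterval)
    {K D₀ D₁ D₂ D₃ : Set (Set κ)} (h₀ : IsLowerSet D₀) (h₁ : IsLowerSet D₁) (h₂ : IsLowerSet D₂) (h₃ : IsLowerSet D₃)
    (h01 : D₀ ∩ D₁ = K) (h02 : D₀ ∩ D₂ = K) (h03 : D₀ ∩ D₃ = K) (h12 : D₁ ∩ D₂ = K) (h13 : D₁ ∩ D₃ = K) (h23 : D₂ ∩ D₃ = K) :
    0 ≤ sahiE4 (prodBernoulli p) D₀ᶜ D₁ᶜ D₂ᶜ D₃ᶜ := by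
  rw [← sahiE_four_ind]
  refine sahiE_four_nonneg_of_pairwise_union_eq h p h₀.compl h₁.compl h₂.compl h₃.compl (W := Kᶜ) ?_ ?_ ?_ ?_ ?_ ?_ <;>
    rw [← Set.compl_inter] <;> simp only [h01, h02, h03, h12, h13, h23]

/-- **Increasing four-petal sunflower** (AT_4, the `m = 4` row of the abstract tower): for increasing `V₀..V₃` with all pairwise intersections `A`,
`CoSunflowerFourRung` gives `0 ≤ E_4(μ_p; V₀ᶜ, V₁ᶜ, V₂ᶜ, V₃ᶜ)` (reflection `ω ↦ ωᶜ`, `p ↦ 1 − p`, then the decreasing form). [this work] -/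
theorem sahiE4_compl_sunflower_nonneg_of_rung (h : CoSunflowerFourRung) {κ : Type} [Fintype κ] (p : κ → unitInterval)
    {A V₀ V₁ V₂ V₃ : Set (Set κ)} (h₀ : IsUpperSet V₀) (h₁ : IsUpperSet V₁) (h₂ : IsUpperSet V₂) (h₃ : IsUpperSet V₃)
    (h01 : V₀ ∩ V₁ = A) (h02 : V₀ ∩ V₂ = A) (h03 : V₀ ∩ V₃ = A) (h12 : V₁ ∩ V₂ = A) (h13 : V₁ ∩ V₃ = A) (h23 : V₂ ∩ V₃ = A) :
    0 ≤ sahiE4 (prodBernoulli p) V₀ᶜ V₁ᶜ V₂ᶜ V₃ᶜ := by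
  rw [SahiHitting.sahiE4_eq_sahiE4_preimage_compl p MeasurableSet.of_discrete MeasurableSet.of_discrete MeasurableSet.of_discrete
    MeasurableSet.of_discrete, Set.preimage_compl, Set.preimage_compl, Set.preimage_compl, Set.preimage_compl]
  exact sahiE4_compl_lowerSunflower_nonneg_of_rung h _
    (Literature.Probability.LatticeModels.isLowerSet_preimage_compl h₀) (Literature.Probability.LatticeModels.isLowerSet_preimage_compl h₁)
    (Literature.Probability.LatticeModels.isLowerSet_preimage_compl h₂) (Literature.Probability.LatticeModels.isLowerSet_preimage_compl h₃)
    (by rw [← Set.preimage_inter, h01]) (by rw [← Set.preimage_inter, h02]) (by rw [← Set.preimage_inter, h03])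
    (by rw [← Set.preimage_inter, h12]) (by rw [← Set.preimage_inter, h13]) (by rw [← Set.preimage_inter, h23])

section FourPoint

open SahiDeltaSystem

variable {V : Type} [Fintype V]

omit [Fintype V] in
/-- Transitivity of open connection (membership form). [folklore] -/
private theorem rtr {x y z : V} {ω : BondConfig V} (h₁ : ω ∈ openConn x y) (h₂ : ω ∈ openConn y z) : ω ∈ openConn x z :=
  SimpleGraph.Reachable.trans h₁ h₂

omit [Fintype V] in
/-- Symmetry of open connection (membership form). [folklore] -/
private theorem rsy {x y : V} {ω : BondConfig V} (h : ω ∈ openConn x y) : ω ∈ openConn y x :=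
  SimpleGraph.Reachable.symm h

omit [Fintype V] in
/-- The four `triConn` events of `a b c d` pairwise intersect in "all four joined" (pair `bcd, acd`). [folklore] -/
theorem triConn_inter₀₁ (a b c d : V) : (triConn b c d ∩ triConn a c d : Set (BondConfig V)) = triConn b c d ∩ openConn a b := by
  ext ω; simp only [triConn, Set.mem_inter_iff]; constructor
  · rintro ⟨⟨h1, h2⟩, h3, -⟩; exact ⟨⟨h1, h2⟩, rtr h3 (rsy h1)⟩
  · rintro ⟨⟨h1, h2⟩, h3⟩; exact ⟨⟨h1, h2⟩, rtr h3 h1, h2⟩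

omit [Fintype V] in
/-- (pair `bcd, abd`). [folklore] -/
theorem triConn_inter₀₂ (a b c d : V) : (triConn b c d ∩ triConn a b d : Set (BondConfig V)) = triConn b c d ∩ openConn a b := by
  ext ω; simp only [triConn, Set.mem_inter_iff]; constructor
  · rintro ⟨⟨h1, h2⟩, h3, -⟩; exact ⟨⟨h1, h2⟩, h3⟩
  · rintro ⟨⟨h1, h2⟩, h3⟩; exact ⟨⟨h1, h2⟩, h3, rtr h1 h2⟩

omit [Fintype V] in
/-- (pair `bcd, abc`). [folklore] -/
theorem triConn_inter₀₃ (a b c d : V) : (triConn b c d ∩ triConn a b c : Set (BondConfig V)) = triConn b c d ∩ openConn a b := by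
  ext ω; simp only [triConn, Set.mem_inter_iff]; constructor
  · rintro ⟨⟨h1, h2⟩, h3, -⟩; exact ⟨⟨h1, h2⟩, h3⟩
  · rintro ⟨⟨h1, h2⟩, h3⟩; exact ⟨⟨h1, h2⟩, h3, h1⟩

omit [Fintype V] in
/-- (pair `acd, abd`). [folklore] -/
theorem triConn_inter₁₂ (a b c d : V) : (triConn a c d ∩ triConn a b d : Set (BondConfig V)) = triConn b c d ∩ openConn a b := by
  ext ω; simp only [triConn, Set.mem_inter_iff]; constructor
  · rintro ⟨⟨h1, h2⟩, h3, -⟩; exact ⟨⟨rtr (rsy h3) h1, h2⟩, h3⟩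
  · rintro ⟨⟨h1, h2⟩, h3⟩; exact ⟨⟨rtr h3 h1, h2⟩, h3, rtr h1 h2⟩

omit [Fintype V] in
/-- (pair `acd, abc`). [folklore] -/
theorem triConn_inter₁₃ (a b c d : V) : (triConn a c d ∩ triConn a b c : Set (BondConfig V)) = triConn b c d ∩ openConn a b := by
  ext ω; simp only [triConn, Set.mem_inter_iff]; constructor
  · rintro ⟨⟨-, h2⟩, h3, h4⟩; exact ⟨⟨h4, h2⟩, h3⟩
  · rintro ⟨⟨h1, h2⟩, h3⟩; exact ⟨⟨rtr h3 h1, h2⟩, h3, h1⟩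

omit [Fintype V] in
/-- (pair `abd, abc`). [folklore] -/
theorem triConn_inter₂₃ (a b c d : V) : (triConn a b d ∩ triConn a b c : Set (BondConfig V)) = triConn b c d ∩ openConn a b := by
  ext ω; simp only [triConn, Set.mem_inter_iff]; constructor
  · rintro ⟨⟨h1, h2⟩, -, h4⟩; exact ⟨⟨h4, rtr (rsy h4) h2⟩, h1⟩
  · rintro ⟨⟨h1, h2⟩, h3⟩; exact ⟨⟨h3, rtr h1 h2⟩, h3, h1⟩

/-- **`CoSunflowerFourRung ⇒ 4PT-LB`** (`SahiDeltaSystem.FourPointLBRow`: `0 ≤ E₄(D_a, D_b, D_c, D_d)` on every finite weighted graph, `D_x` = "the three terminals other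
than `x` are not all in one open cluster"): the events `triConn` are increasing and form a four-petal sunflower with core "all four joined". [this work] -/
theorem fourPointLBRow_of_coSunflowerFourRung (h : CoSunflowerFourRung) : FourPointLBRow := by
  intro V _ w a b c d
  exact sahiE4_compl_sunflower_nonneg_of_rung h w (isUpperSet_triConn b c d) (isUpperSet_triConn a c d)
    (isUpperSet_triConn a b d) (isUpperSet_triConn a b c) (triConn_inter₀₁ a b c d) (triConn_inter₀₂ a b c d)
    (triConn_inter₀₃ a b c d) (triConn_inter₁₂ a b c d) (triConn_inter₁₃ a b c d) (triConn_inter₂₃ a b c d)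

end FourPoint

end SahiCoSunflowerFourRung

end Summit.CriticalPhenomena.PercolationContinuityZ3.Theorems
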